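import Summits.QuantumFields.YangMills.Theorems.BalabanUVNodesK0RecordFormatNamesIntLocal

/-!
# K0⁷ — EDITION 13c: THE WRAP-AWARE RESIDUE `IntLocalFormula.ResidueAtW` (porter PT-A-1 g3's located RESIDUE-WRAP-DEFECT, memo `RESIDUE-WRAP-DEFECT-v1.md` e62279e2dd79b484 §3):
# ONE integer-local formula `Ψ` for the domains OFF the centred wrap class `recordWrapCtr` + FREE torus-level pieces `Ew n X` ON it, with their own rows (a)(b)(c)(d); (e) asked of
# nobody on the wrap class; (f′) split accordingly

DEFINER seat `ym-nodeO-def-1` (gen 34).  WHY (porter's kernel finding `…PortS1FlatBlind`, p801920): a window-local `SL(2,ℂ)`-invariant INTEGER formula pulled back through `cover : ℤ⁴ → T_K`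
is blind to flat backgrounds with non-trivial Polyakov loops, so ed.13's `IntFormula.Represents` (ONE Ψ at EVERY domain, wrapping ones included) is generically UNINHABITABLE at the record —
print's (1.7) makes wrapping pieces torus functions and (1.21) binds only non-wrapping pieces across volumes.  Ed.13's `Represents ∕ ResidueAt` STAY as the non-wrapping half's currency; this
leaf adds the wrap-aware receipts the porter's `formatPlusG_recordJ_of_wrapAwareResidue ∕ sig27930v8LR4_of_residueW` consume.  `--kind definition --supports stmt-QuantumFields-20541 --as helper`;
count-neutral.  [I] = [Balaban1987RG1].

WHAT THIS FILE IS (definitions only): `TorusPieces` (the type of the free wrap-class pieces `Ew n X : CPair → ℂ`); `pairCutTorusAt` (the (1.9) pair of `U_{k+1}(W_B)` CUT TO `X` at the TORUS level —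
`pairCutAt` of ed.13 is its pull-back); OFF-WRAP receipts for `Ψ`: `AnalyticOnUcOff`, `Bound118OnUcOff`; ON-WRAP receipts for `Ew`: `TorusPieces.AnalyticOnW` (a), `Bound118OnW` (b), `LocalOnW` (c),
`GaugeInvOnW` (d); the split pair identity `IntFormula.RepresentsW Ψ Ew Φf` ((f′)-W); the bundle `IntLocalFormula.ResidueAtW`.

HONEST FRAMING.  Definitions only; nothing of Bałaban asserted, ported or discharged; the residue-W is NOT proved; 27930⁸ OPEN · NOT refuted (the signed `FormatPlusG` text is not hit); K0⁷ OPEN;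
NODE O 0∕1; COUNT 8∕28 · K 1∕4 UNMOVED; finite `𝕋⁴_{L^K}` at fixed ε — NOT continuum ∕ ℝ⁴ ∕ OS; **the Yang–Mills mass gap (Clay) is NOT proved by any of this.**  No `sorry`, `instance`, `notation`.
-/

noncomputable section

open scoped BigOperators Matrix.Norms.L2Operator Topology

namespace Summit.QuantumFields.YangMills.Theorems.K0RecordFormatNames

open Literature.MathematicalPhysics.QuantumFieldTheory.Balaban1983to89
open Literature.MathematicalPhysics.QuantumFieldTheory.Balaban1983to89.Node00
open Literature.MathematicalPhysics.QuantumFieldTheory.Balaban1983to89.T4Continuum (T4Family)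
open Literature.MathematicalPhysics.QuantumFieldTheory.Balaban1983to89.B15Eq112TorusCover (cover)
open _root_.Filter

variable (F : T4Family)

/-- **The type of the FREE TORUS-LEVEL PIECES on the wrap class**: `Ew n X : Sect2.CPair (F.P (K₀+n)) (MatA 2) → ℂ` (functions of the pair ON THE TORUS — they may see Polyakov loops,
as print's (1.7) «depends on U_j restricted to X» allows for wrapping X). [cite: Balaban1987RG1, (1.7) p.261, (1.9) p.261] -/
abbrev TorusPieces (Mc k : ℕ) : Type :=
  (n : ℕ) → (recordDomSys F Mc k (recordK₀ F Mc k + n)).Dom → Sect2.CPair (F.P (recordK₀ F Mc k + n)) (MatA 2) → ℂ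

open scoped Classical in
/-- **The (1.9) pair of `U_{k+1}(W_B)` CUT TO `X` at the TORUS level** (rooted gauge; `1 ∕ 0` off the bonds of `X`); `pairCutAt` (ed.13) is its pull-back `pullPair`.
[cite: Balaban1987RG1, (1.7)–(1.9) p.261] -/
def pairCutTorusAt (a₀ ε₂₉ : ℝ) (Mc k K : ℕ) (X : (recordDomSys F Mc k K).Dom) (B : recordW F a₀ ε₂₉ k K) : Sect2.CPair (F.P K) (MatA 2) :=
  letI θ := thetaFill F a₀ ε₂₉
  letI := θ.instVβ₁; letI := θ.instVβ₂; letI := θ.instιβ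
  (fun b => if b ∈ domBonds F Mc k K X then ((recordBgField F θ k K B b : SU 2) : MatA 2) else 1,
   fun b => if b ∈ domBonds F Mc k K X then recordCurrent F θ k K B b else 0)

/-! ## Off-wrap receipts for the integer formula `Ψ` -/

/-- **(a) OFF THE WRAP CLASS**: analyticity of the pull-back pieces at pairs of `recordUc … X` for `X ∉ recordWrapCtr`. [cite: Balaban1987RG1, (1.18) p.263, (1.21) p.264] -/
def IntFormula.AnalyticOnUcOff (Ψ : IntFormula) (Mc k : ℕ) (α₀ α₁ : ℝ) : Prop :=
  ∀ n (X : (recordDomSys F Mc k (recordK₀ F Mc k + n)).Dom), X ∉ recordWrapCtr F Mc k (recordK₀ F Mc k + n) →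
    ∀ φ : Sect2.CPair (F.P (recordK₀ F Mc k + n)) (MatA 2),
      encodeCfg F (recordK₀ F Mc k + n) φ ∈ recordUc F Mc k α₀ α₁ (recordK₀ F Mc k + n) X →
        AnalyticAt ℂ (fun ψ => Ψ.piece F Mc k (recordK₀ F Mc k + n) X ψ) φ

/-- **(b) OFF THE WRAP CLASS**: the (1.18) bound of the pull-back pieces for `X ∉ recordWrapCtr`. [cite: Balaban1987RG1, (1.18) p.263] -/
def IntFormula.Bound118OnUcOff (Ψ : IntFormula) (Mc k : ℕ) (α₀ α₁ E₀ κ : ℝ) : Prop :=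
  ∀ n (X : (recordDomSys F Mc k (recordK₀ F Mc k + n)).Dom), X ∉ recordWrapCtr F Mc k (recordK₀ F Mc k + n) →
    ∀ φ : Sect2.CPair (F.P (recordK₀ F Mc k + n)) (MatA 2),
      encodeCfg F (recordK₀ F Mc k + n) φ ∈ recordUc F Mc k α₀ α₁ (recordK₀ F Mc k + n) X →
        ‖Ψ.piece F Mc k (recordK₀ F Mc k + n) X φ‖ ≤ E₀ * Real.exp (-κ * (recordDomSys F Mc k (recordK₀ F Mc k + n)).dj X)

/-! ## On-wrap receipts for the free torus pieces `Ew` -/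

/-- **(a) ON THE WRAP CLASS** for the free torus pieces. [cite: Balaban1987RG1, (1.18) p.263, (1.9) p.261] -/
def TorusPieces.AnalyticOnW {Mc k : ℕ} (Ew : TorusPieces F Mc k) (α₀ α₁ : ℝ) : Prop :=
  ∀ n (X : (recordDomSys F Mc k (recordK₀ F Mc k + n)).Dom), X ∈ recordWrapCtr F Mc k (recordK₀ F Mc k + n) →
    ∀ φ, encodeCfg F (recordK₀ F Mc k + n) φ ∈ recordUc F Mc k α₀ α₁ (recordK₀ F Mc k + n) X → AnalyticAt ℂ (Ew n X) φ

/-- **(b) ON THE WRAP CLASS**: `‖Ew n X φ‖ ≤ E₀ e^{−κ d(X)}` on `recordUc … X`. [cite: Balaban1987RG1, (1.18) p.263] -/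
def TorusPieces.Bound118OnW {Mc k : ℕ} (Ew : TorusPieces F Mc k) (α₀ α₁ E₀ κ : ℝ) : Prop :=
  ∀ n (X : (recordDomSys F Mc k (recordK₀ F Mc k + n)).Dom), X ∈ recordWrapCtr F Mc k (recordK₀ F Mc k + n) →
    ∀ φ, encodeCfg F (recordK₀ F Mc k + n) φ ∈ recordUc F Mc k α₀ α₁ (recordK₀ F Mc k + n) X →
      ‖Ew n X φ‖ ≤ E₀ * Real.exp (-κ * (recordDomSys F Mc k (recordK₀ F Mc k + n)).dj X)

/-- **(c) ON THE WRAP CLASS**: (1.7) locality — `Ew n X` depends on the pair restricted to the sites of `X`. [cite: Balaban1987RG1, (1.7) p.261] -/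
def TorusPieces.LocalOnW {Mc k : ℕ} (Ew : TorusPieces F Mc k) : Prop :=
  ∀ n (X : (recordDomSys F Mc k (recordK₀ F Mc k + n)).Dom), X ∈ recordWrapCtr F Mc k (recordK₀ F Mc k + n) →
    ∀ φ ψ, Sect2.agreeOnSet (Sect2.domSites (F.P (recordK₀ F Mc k + n)) Mc (k + 1) X) φ ψ → Ew n X φ = Ew n X ψ

/-- **(d) ON THE WRAP CLASS**: (1.19) invariance under the `SL(2,ℂ)`-valued lattice gauge group (`Sect2.cAct`). [cite: Balaban1987RG1, (1.19) p.263, (1.10) p.262] -/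
def TorusPieces.GaugeInvOnW {Mc k : ℕ} (Ew : TorusPieces F Mc k) : Prop :=
  ∀ n (X : (recordDomSys F Mc k (recordK₀ F Mc k + n)).Dom), X ∈ recordWrapCtr F Mc k (recordK₀ F Mc k + n) →
    ∀ (u : recordGaugeGrp F (recordK₀ F Mc k + n)) φ, Ew n X (Sect2.cAct u.1 φ) = Ew n X φ

/-! ## The split (f′) and the bundle -/

open scoped Classical in
/-- **(f′)-W, THE WRAP-AWARE PAIR IDENTITY near `B = 0`**: `Φf n B = Σ_X (if X ∈ recordWrapCtr then Ew n X (pair cut to X) else Ψ(X̂)(pulled-back pair cut to X))` eventually at `0` — the porter's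
`Ep n X := if X ∈ wrap then Ew n X else Ψ-pull-back`. [cite: Balaban1987RG1, (1.6)–(1.9) p.261, (1.21) p.264] -/
def IntFormula.RepresentsW (Ψ : IntFormula) (a₀ ε₂₉ : ℝ) (Mc k : ℕ) (Ew : TorusPieces F Mc k)
    (Φf : (n : ℕ) → recordW F a₀ ε₂₉ k (recordK₀ F Mc k + n) → ℂ) : Prop :=
  ∀ n, letI θ := thetaFill F a₀ ε₂₉; letI := θ.instVβ₁; letI := θ.instVβ₂; letI := θ.instιβ
    ∀ᶠ B in 𝓝 (0 : recordW F a₀ ε₂₉ k (recordK₀ F Mc k + n)),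
      Φf n B = ∑ X : (recordDomSys F Mc k (recordK₀ F Mc k + n)).Dom,
        (if X ∈ recordWrapCtr F Mc k (recordK₀ F Mc k + n) then
          Ew n X (pairCutTorusAt F a₀ ε₂₉ Mc k (recordK₀ F Mc k + n) X B)
        else Ψ (intCubes F Mc k (recordK₀ F Mc k + n) X) (pairCutAt F a₀ ε₂₉ Mc k (recordK₀ F Mc k + n) X B))

/-- **THE WRAP-AWARE RESIDUE AT ONE OBJECT + FREE WRAP PIECES**: (a)(b) for `Ψ` OFF the wrap class, (a)(b)(c)(d) for `Ew` ON it, and (f′)-W — what PT-A's closing road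
`sig27930v8LR4_of_residueW` consumes ((e) is asked of nobody on the wrap class, faithful to `PieceVolIndep`). [cite: Balaban1987RG1, (1.7) p.261, (1.18)–(1.19) p.263, (1.21) p.264] -/
def IntLocalFormula.ResidueAtW (Mc k : ℕ) (Ψ : IntLocalFormula (F.L ^ (k + 1) * Mc)) (Ew : TorusPieces F Mc k) (a₀ ε₂₉ α₀ α₁ E₀ κ : ℝ)
    (Φf : (n : ℕ) → recordW F a₀ ε₂₉ k (recordK₀ F Mc k + n) → ℂ) : Prop :=
  Ψ.Ψ.AnalyticOnUcOff F Mc k α₀ α₁ ∧ Ψ.Ψ.Bound118OnUcOff F Mc k α₀ α₁ E₀ κ ∧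
    Ew.AnalyticOnW F α₀ α₁ ∧ Ew.Bound118OnW F α₀ α₁ E₀ κ ∧ Ew.LocalOnW F ∧ Ew.GaugeInvOnW F ∧
    Ψ.Ψ.RepresentsW F a₀ ε₂₉ Mc k Ew Φf

end Summit.QuantumFields.YangMills.Theorems.K0RecordFormatNames

end
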